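import Literature.NumberTheory.EllipticCurves.EisensteinNumberDistribution
import HarnessLib

/-!
# Eisenstein numbers of the order `ℤ[(1 + √-q)/2]` at division points as weight-one theta
# `L`-values

Topic `Literature/NumberTheory/EllipticCurves` (complex-lattice cluster); namespace
`Literature.NumberTheory.EllipticCurves.QuadOrder`. Companion of `BinaryLatticeKroneckerLimit.lean`
(the lattices `Λ_N = ℤ√-N + ℤ`) for the lattices

  `𝒪_q = ℤ ω_q + ℤ`,  `ω_q = (1 + √-q)/2`  (`QuadOrder.periodPair q`),

which for `q ≡ 3 (mod 4)` squarefree are the rings of integers of the imaginary quadratic fields of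
odd discriminant `-q` (seven of the nine fields of class number one: `q = 3, 7, 11, 19, 43, 67,
163`), the lattices `L = Ω𝒪` of Rubin, LNM 1716, §7.4. Since `Λ_q ⊆ 𝒪_q` with index `2` and
representatives `{0, ω_q}` (`2ω_q = 1 + √-q ∈ Λ_q`), the distribution relation of
`EisensteinNumberDistribution.lean` reduces the Eisenstein numbers `E₁(z; 𝒪_q)` (Rubin Def. 7.11,
Prop. 7.12 at `k = 1`; `PeriodPair.eisensteinE₁ = ζ − η`) to those of `Λ_q`, which
`BinaryLatticeKroneckerLimit` expresses through the entire theta `L`-functions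
`BinaryTheta.thetaLFunction q M 1 (-τ_q) Ψ` of `BinaryThetaSeries.lean`:

* `QuadOrder.eisensteinE₁_eq_add` — `E₁(z; 𝒪_q) = E₁(z; Λ_q) + E₁(z + ω_q; Λ_q)` for all `z`;
* `QuadOrder.eisensteinE₁_divPoint` — **Eisenstein numbers at `M`-division points of `𝒪_q` are
  theta `L`-values at `s = 1`** (Rubin Prop. 7.15 at `k = 1`, character-free, odd discriminant):
  for `d = (d₁, d₂) mod M`,
  `E₁((d₁ + d₂ω_q)/M; 𝒪_q) = 2M · (L_{c₀}(1) + L_{c₁}(1))`, where `L_c(s)` is the continuation of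
  the class series `∑_{y ≡ c (2M)} (y₁ − y₂τ_q)(y₁² + q y₂²)^{-s}` on `Λ_q` and `c₀, c₁` are the two
  classes of `ℤ²` modulo `2M` lying over `d` under `y = 2γ`, `γ = d₁ + d₂ ω_q`
  (`y = (2d₁ + d₂ + eM, d₂ + eM)`, `e = 0, 1`; `QuadOrder.lift`);
* `QuadOrder.thetaLFunction_parityLift_one` — **the finite formula**: for `Φ : ℤ × ℤ → ℂ`
  periodic modulo `M` (a function on `𝒪_q/M𝒪_q` in the coordinates `γ = d₁ + d₂ω_q`),
  `thetaLFunction q (2M) 1 (-τ_q) Φ♯ 1 = (2M)⁻¹ ∑_{d mod M} Φ(d) E₁((d₁ + d₂ω_q)/M; 𝒪_q)`, where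
  `Φ♯(y) = Φ((y₁ − y₂)/2, y₂)` on `y₁ ≡ y₂ (2)` and `0` otherwise (`QuadOrder.parityLift`) is the
  coefficient of the Dirichlet series `∑_{γ ∈ 𝒪_q ∖ 0} Φ(γ) \overline{2γ} |2γ|^{-2s}
  = 2^{1-2s} ∑ Φ(γ) γ̄ |γ|^{-2s}` written on `Λ_q ∋ 2γ`.

These are the weight-one `L`-values `L_𝔪(ψ̄, 1, 𝔠)` of Rubin's Prop. 7.15 / Thm. 7.17 for the CM
fields of odd discriminant, up to the bookkeeping between `𝒪_q/M` and `ℤ²/2M`, which is done here.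
Everything is proved; the only definitions are `QuadOrder.omega/tauH/periodPair/divPoint/lift/
parityLift` (all with bodies).

## References

* K. Rubin, *Elliptic curves with complex multiplication and the conjecture of Birch and
  Swinnerton-Dyer*, LNM 1716 (1999), §7.4: Def. 7.11, Prop. 7.12, Prop. 7.15 (held:
  `book:coates1999-arithmetic-theory-elliptic-curves`, pp. 244–245). [Rubin1999]
* E. Hecke, Math. Z. 6 (1920), §9. [Hecke1920]
-/

noncomputable section

open Complex Real Filter Topology PeriodPair
open Literature.NumberTheory.LFunctions Literature.NumberTheory.LFunctions.BinaryTheta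
open scoped ComplexConjugate

namespace Literature.NumberTheory.EllipticCurves

namespace QuadOrder

variable (q : ℕ) [NeZero q]

/-! ### The lattice `𝒪_q = ℤ ω_q + ℤ`, `ω_q = (1 + √-q)/2` -/

/-- `ω_q = (1 + √q · i)/2`. [folklore] -/
def omega : ℂ := (1 + (Real.sqrt q : ℂ) * I) / 2

omit [NeZero q] in
/-- `2 ω_q = 1 + τ_q`, `τ_q = √q · i`. [folklore] -/
theorem two_mul_omega : 2 * omega q = 1 + (Real.sqrt q : ℂ) * I := by
  unfold omega; ring

omit [NeZero q] in
/-- `Im ω_q = √q / 2`. [folklore] -/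
theorem omega_im : (omega q).im = Real.sqrt q / 2 := by
  simp [omega, Complex.add_im, Complex.mul_im, Complex.div_ofNat_im]

/-- `ω_q` as a point of the upper half plane. [folklore] -/
def tauH : UpperHalfPlane :=
  ⟨omega q, by rw [omega_im]; exact div_pos (BinaryLattice.sqrt_pos q) two_pos⟩

/-- `(tauH q : ℂ) = ω_q`. [folklore] -/
@[simp] theorem coe_tauH : ((tauH q : UpperHalfPlane) : ℂ) = omega q := rfl

/-- The lattice `𝒪_q = ℤ ω_q + ℤ` as a period pair `(ω_q, 1)`. [folklore] -/
def periodPair : PeriodPair := PeriodPair.ofUpperHalfPlane (tauH q)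

/-- Membership in `𝒪_q`: `x ∈ 𝒪_q ↔ x = m ω_q + n`. [folklore] -/
theorem mem_lattice_iff {x : ℂ} : x ∈ (periodPair q).lattice ↔ ∃ m n : ℤ, m * omega q + n = x := by
  rw [periodPair, PeriodPair.mem_lattice]
  simp

/-- Membership in `Λ_q`: `x ∈ Λ_q ↔ x = m τ_q + n`. [folklore] -/
theorem mem_binaryLattice_iff {x : ℂ} :
    x ∈ (BinaryLattice.periodPair q).lattice ↔ ∃ m n : ℤ, m * ((Real.sqrt q : ℂ) * I) + n = x := by
  rw [BinaryLattice.periodPair, PeriodPair.mem_lattice]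
  simp [BinaryLattice.coe_tau]

/-- `Λ_q ⊆ 𝒪_q` (`τ_q = 2ω_q − 1`). [folklore] -/
theorem binaryLattice_le : (BinaryLattice.periodPair q).lattice ≤ (periodPair q).lattice := by
  intro x hx
  obtain ⟨m, n, rfl⟩ := (mem_binaryLattice_iff q).mp hx
  refine (mem_lattice_iff q).mpr ⟨2 * m, n - m, ?_⟩
  rw [show (Real.sqrt q : ℂ) * I = 2 * omega q - 1 by rw [two_mul_omega]; ring]
  push_cast
  ring

/-- `2ω_q ∈ Λ_q`. [folklore] -/
theorem two_mul_omega_mem : 2 * omega q ∈ (BinaryLattice.periodPair q).lattice :=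
  (mem_binaryLattice_iff q).mpr ⟨1, 1, by rw [two_mul_omega]; push_cast; ring⟩

/-- `ω_q ∉ Λ_q` (imaginary parts: `m√q ≠ √q/2`). [folklore] -/
theorem omega_notMem : omega q ∉ (BinaryLattice.periodPair q).lattice := by
  intro h
  obtain ⟨m, n, hmn⟩ := (mem_binaryLattice_iff q).mp h
  have him := congrArg Complex.im hmn
  rw [omega_im] at him
  simp only [Complex.add_im, Complex.mul_im, Complex.intCast_re, Complex.intCast_im,
    Complex.mul_re, Complex.ofReal_re, Complex.I_re, Complex.ofReal_im, Complex.I_im,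
    mul_zero, sub_zero, mul_one, add_zero] at him
  have hs : (0 : ℝ) < Real.sqrt q := BinaryLattice.sqrt_pos q
  have h2 : (2 * (m : ℝ) - 1) * Real.sqrt q = 0 := by linear_combination 2 * him
  rcases mul_eq_zero.mp h2 with h3 | h3
  · have h4 : (2 * m - 1 : ℤ) = 0 := by exact_mod_cast h3
    omega
  · exact hs.ne' h3

/-- `𝒪_q = Λ_q ∪ (ω_q + Λ_q)`: `{0, ω_q}` is a system of representatives of `𝒪_q/Λ_q`. [folklore] -/
theorem reps_iff (x : ℂ) : x ∈ (periodPair q).lattice ↔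
    ∃ c ∈ ({0, omega q} : Finset ℂ), x - c ∈ (BinaryLattice.periodPair q).lattice := by
  constructor
  · intro hx
    obtain ⟨m, n, rfl⟩ := (mem_lattice_iff q).mp hx
    rcases Int.even_or_odd m with ⟨k, rfl⟩ | ⟨k, rfl⟩
    · refine ⟨0, by simp, (mem_binaryLattice_iff q).mpr ⟨k, n + k, ?_⟩⟩
      rw [show (Real.sqrt q : ℂ) * I = 2 * omega q - 1 by rw [two_mul_omega]; ring]
      push_cast; ring
    · refine ⟨omega q, by simp, (mem_binaryLattice_iff q).mpr ⟨k, n + k, ?_⟩⟩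
      rw [show (Real.sqrt q : ℂ) * I = 2 * omega q - 1 by rw [two_mul_omega]; ring]
      push_cast; ring
  · rintro ⟨c, hc, hxc⟩
    have hle := binaryLattice_le q
    simp only [Finset.mem_insert, Finset.mem_singleton] at hc
    rcases hc with rfl | rfl
    · simpa using hle hxc
    · have : x = (x - omega q) + omega q := by ring
      rw [this]
      exact add_mem (hle hxc) ((mem_lattice_iff q).mpr ⟨1, 0, by push_cast; ring⟩)

/-- The representatives `0, ω_q` are distinct modulo `Λ_q`. [folklore] -/
theorem reps_distinct : ∀ c ∈ ({0, omega q} : Finset ℂ), ∀ c' ∈ ({0, omega q} : Finset ℂ),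
    c - c' ∈ (BinaryLattice.periodPair q).lattice → c = c' := by
  intro c hc c' hc' h
  simp only [Finset.mem_insert, Finset.mem_singleton] at hc hc'
  rcases hc with rfl | rfl <;> rcases hc' with rfl | rfl
  · rfl
  · exact absurd (by simpa using neg_mem h) (omega_notMem q)
  · exact absurd (by simpa using h) (omega_notMem q)
  · rfl

/-- `0 ≠ ω_q`. [folklore] -/
theorem omega_ne_zero : omega q ≠ 0 := fun h ↦
  omega_notMem q (h ▸ zero_mem _)

/-! ### `E₁(z; 𝒪_q)` through `E₁(·; Λ_q)` -/

/-- **`E₁(z; 𝒪_q) = E₁(z; Λ_q) + E₁(z − ω_q; Λ_q)` for every `z`** — the distribution relation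
(`PeriodPair.sum_eisensteinE₁_sub_eq`) for `Λ_q ⊆ 𝒪_q` with representatives `{0, ω_q}`; at the
points of `𝒪_q` both sides vanish (`E₁` vanishes at points of order dividing `2`).
[cite: Rubin1999, §7.4 Def. 7.11 and Thm. 7.13] -/
theorem eisensteinE₁_eq_add_sub (z : ℂ) :
    (periodPair q).eisensteinE₁ z =
      (BinaryLattice.periodPair q).eisensteinE₁ z +
        (BinaryLattice.periodPair q).eisensteinE₁ (z - omega q) := by
  by_cases hz : z ∈ (periodPair q).lattice
  · -- both sides vanish
    rw [(periodPair q).eisensteinE₁_eq_zero_of_mem_lattice hz]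
    obtain ⟨c, hc, hzc⟩ := (reps_iff q z).mp hz
    simp only [Finset.mem_insert, Finset.mem_singleton] at hc
    rcases hc with rfl | rfl
    · rw [sub_zero] at hzc
      rw [(BinaryLattice.periodPair q).eisensteinE₁_eq_zero_of_mem_lattice hzc,
        (BinaryLattice.periodPair q).eisensteinE₁_eq_zero_of_two_mul_mem_lattice]
      · ring
      · rw [mul_sub]
        exact sub_mem (by simpa [two_mul] using add_mem hzc hzc) (two_mul_omega_mem q)
    · rw [(BinaryLattice.periodPair q).eisensteinE₁_eq_zero_of_mem_lattice hzc,
        (BinaryLattice.periodPair q).eisensteinE₁_eq_zero_of_two_mul_mem_lattice]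
      · ring
      · have : 2 * z = 2 * (z - omega q) + 2 * omega q := by ring
        rw [this]
        exact add_mem (by simpa [two_mul] using add_mem hzc hzc) (two_mul_omega_mem q)
  · have h := sum_eisensteinE₁_sub_eq (reps_iff q) (by simp) (reps_distinct q) hz
    rw [Finset.sum_pair (omega_ne_zero q).symm, sub_zero] at h
    exact h.symm

/-- `E₁(z; 𝒪_q) = E₁(z; Λ_q) + E₁(z + ω_q; Λ_q)` (`z + ω_q ≡ z − ω_q (mod Λ_q)`).
[cite: Rubin1999, §7.4 Def. 7.11 and Thm. 7.13] -/
theorem eisensteinE₁_eq_add (z : ℂ) :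
    (periodPair q).eisensteinE₁ z =
      (BinaryLattice.periodPair q).eisensteinE₁ z +
        (BinaryLattice.periodPair q).eisensteinE₁ (z + omega q) := by
  rw [eisensteinE₁_eq_add_sub]
  congr 1
  have : z + omega q = (z - omega q) + 2 * omega q := by ring
  rw [this, (BinaryLattice.periodPair q).eisensteinE₁_add_of_mem_lattice (two_mul_omega_mem q)]

/-! ### Division points of `𝒪_q` and their two lifts to `ℤ²/2M` -/

variable (M : ℕ) [NeZero M]

/-- The `M`-division point `(d₁ + d₂ ω_q)/M` of `ℂ/𝒪_q` attached to `d mod M` (canonical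
representatives `0 ≤ dᵢ < M`). [folklore] -/
def divPoint (d : ZMod M × ZMod M) : ℂ := ((d.1.val : ℂ) + (d.2.val : ℂ) * omega q) / M

/-- The two classes of `ℤ²` modulo `2M` over `d mod M` under `γ = d₁ + d₂ω_q ↦ 2γ = (2d₁ + d₂) +
d₂ τ_q`: `lift e d = (2d₁ + d₂ + eM, d₂ + eM)`, `e = 0, 1` (the lift `e = 1` corresponds to
`γ + Mω_q`). [folklore] -/
def lift (e : Fin 2) (d : ZMod M × ZMod M) : ZMod (2 * M) × ZMod (2 * M) :=
  (((2 * d.1.val + d.2.val + e * M : ℕ) : ZMod (2 * M)), ((d.2.val + e * M : ℕ) : ZMod (2 * M)))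

omit [NeZero M] in
/-- The canonical representative of `n mod m` differs from `n` by a multiple of `m`. [folklore] -/
theorem exists_val_natCast_eq (m n : ℕ) [NeZero m] :
    ∃ j : ℤ, (((n : ZMod m)).val : ℤ) = n + m * j := by
  refine ⟨-(n / m : ℕ), ?_⟩
  rw [ZMod.val_natCast]
  have h : ((n % m : ℕ) : ℤ) + m * (n / m : ℕ) = n := by exact_mod_cast Nat.mod_add_div n m
  push_cast at h ⊢
  linear_combination h

/-- **The `Λ_q`-division point of the lift is the `𝒪_q`-division point shifted by `eω_q`, modulo
`Λ_q`**: `divPoint_{Λ_q, 2M}(lift e d) − ((d₁ + d₂ω_q)/M + e ω_q) ∈ Λ_q`. [folklore] -/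
theorem divPoint_lift_sub_mem (e : Fin 2) (d : ZMod M × ZMod M) :
    BinaryLattice.divPoint q (2 * M) (lift M e d) - (divPoint q M d + (e : ℕ) * omega q) ∈
      (BinaryLattice.periodPair q).lattice := by
  obtain ⟨j₁, hj₁⟩ := exists_val_natCast_eq (2 * M) (2 * d.1.val + d.2.val + e * M)
  obtain ⟨j₂, hj₂⟩ := exists_val_natCast_eq (2 * M) (d.2.val + e * M)
  refine (mem_binaryLattice_iff q).mpr ⟨j₂, j₁, ?_⟩
  have hM : (M : ℂ) ≠ 0 := Nat.cast_ne_zero.mpr (NeZero.ne M)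
  have h1 : (((lift M e d).1.val : ℤ) : ℂ) = (2 * d.1.val + d.2.val + (e : ℕ) * M : ℕ) + (2 * M : ℕ) * (j₁ : ℂ) := by
    simp only [lift]; exact_mod_cast hj₁
  have h2 : (((lift M e d).2.val : ℤ) : ℂ) = (d.2.val + (e : ℕ) * M : ℕ) + (2 * M : ℕ) * (j₂ : ℂ) := by
    simp only [lift]; exact_mod_cast hj₂
  rw [BinaryLattice.divPoint, divPoint, h1, h2, omega]
  push_cast
  field_simp
  ring

/-- `E₁` of `Λ_q` at the lifted division point: `E₁(divPoint(lift e d); Λ_q) =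
E₁((d₁ + d₂ω_q)/M + eω_q; Λ_q)`. [folklore] -/
theorem eisensteinE₁_divPoint_lift (e : Fin 2) (d : ZMod M × ZMod M) :
    (BinaryLattice.periodPair q).eisensteinE₁ (BinaryLattice.divPoint q (2 * M) (lift M e d)) =
      (BinaryLattice.periodPair q).eisensteinE₁ (divPoint q M d + (e : ℕ) * omega q) := by
  have h := divPoint_lift_sub_mem q M e d
  have := (BinaryLattice.periodPair q).eisensteinE₁_add_of_mem_lattice h
    (divPoint q M d + (e : ℕ) * omega q)
  rw [add_sub_cancel] at this
  exact this

/-- **Eisenstein numbers of `𝒪_q` at division points are weight-one theta `L`-values** (Rubin,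
LNM 1716, Prop. 7.15 at `k = 1`, character-free form, odd discriminant): for `d mod M`,

  `E₁((d₁ + d₂ω_q)/M; 𝒪_q) = 2M · (L_{c₀}(1) + L_{c₁}(1))`,

`L_c = thetaLFunction q (2M) 1 (-τ_q) 𝟙_c` the entire continuation of
`∑_{y ≡ c (2M)} (y₁ − y₂τ_q)(y₁² + qy₂²)^{-s}` and `c_e = lift e d` the two classes of `2γ`,
`γ ∈ d + M𝒪_q`. (So the value at `s = 1` of the continuation of `∑_{γ ≡ d (M𝒪_q)} \overline{2γ}
|2γ|^{-2s}` is `(2M)⁻¹ E₁((d₁ + d₂ω_q)/M; 𝒪_q)`.)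
[cite: Rubin1999, §7.4 Prop. 7.12 and Prop. 7.15 (LNM 1716 pp. 244–245)] -/
theorem eisensteinE₁_divPoint (d : ZMod M × ZMod M) :
    (periodPair q).eisensteinE₁ (divPoint q M d) =
      ((2 * M : ℕ) : ℂ) *
        (thetaLFunction q (2 * M) 1 (-((Real.sqrt q : ℂ) * I))
            (BinaryLattice.classInd (2 * M) (lift M 0 d)) 1 +
          thetaLFunction q (2 * M) 1 (-((Real.sqrt q : ℂ) * I))
            (BinaryLattice.classInd (2 * M) (lift M 1 d)) 1) := by
  rw [mul_add, BinaryLattice.thetaLFunction_classInd_one, BinaryLattice.thetaLFunction_classInd_one,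
    eisensteinE₁_divPoint_lift, eisensteinE₁_divPoint_lift, eisensteinE₁_eq_add]
  simp

/-! ### The finite formula for a periodic coefficient on `𝒪_q` -/

/-- The coefficient on `ℤ² ≅ Λ_q ∋ 2γ` induced by a coefficient `Φ` on `ℤ² ≅ 𝒪_q ∋ γ = d₁ + d₂ω_q`:
`Φ♯(y) = Φ((y₁ − y₂)/2, y₂)` if `y₁ ≡ y₂ (mod 2)` (i.e. `y = 2γ`, `γ = (y₁ − y₂)/2 + y₂ ω_q`), and
`0` otherwise. [folklore] -/
def parityLift (Φ : ℤ × ℤ → ℂ) (y : ℤ × ℤ) : ℂ :=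
  if 2 ∣ y.1 - y.2 then Φ ((y.1 - y.2) / 2, y.2) else 0

omit [NeZero M] in
/-- `Φ♯` is periodic modulo `2M` when `Φ` is periodic modulo `M`. [folklore] -/
theorem parityLift_periodic (Φ : ℤ × ℤ → ℂ)
    (hΦ : ∀ d z : ℤ × ℤ, Φ (d.1 + M * z.1, d.2 + M * z.2) = Φ d) (y z : ℤ × ℤ) :
    parityLift Φ (y.1 + (2 * M : ℕ) * z.1, y.2 + (2 * M : ℕ) * z.2) = parityLift Φ y := by
  unfold parityLift
  have hiff : (2 : ℤ) ∣ y.1 + (2 * M : ℕ) * z.1 - (y.2 + (2 * M : ℕ) * z.2) ↔ 2 ∣ y.1 - y.2 := by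
    have : y.1 + (2 * M : ℕ) * z.1 - (y.2 + (2 * M : ℕ) * z.2) = (y.1 - y.2) + 2 * (M * (z.1 - z.2)) := by
      push_cast; ring
    rw [this, dvd_add_left (dvd_mul_right 2 _)]
  by_cases h : (2 : ℤ) ∣ y.1 - y.2
  · rw [if_pos (hiff.mpr h), if_pos h]
    obtain ⟨k, hk⟩ := h
    have e1 : (y.1 + (2 * M : ℕ) * z.1 - (y.2 + (2 * M : ℕ) * z.2)) / 2 = k + M * (z.1 - z.2) := by
      have : y.1 + (2 * M : ℕ) * z.1 - (y.2 + (2 * M : ℕ) * z.2) = 2 * (k + M * (z.1 - z.2)) := by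
        push_cast; linear_combination hk
      rw [this, Int.mul_ediv_cancel_left _ two_ne_zero]
    have e2 : (y.1 - y.2) / 2 = k := by rw [hk, Int.mul_ediv_cancel_left _ two_ne_zero]
    rw [e1, e2]
    have := hΦ (k, y.2) (z.1 - z.2, 2 * z.2)
    simp only at this
    rw [← this]
    congr 1
    push_cast
    ring
  · rw [if_neg (fun h' ↦ h (hiff.mp h')), if_neg h]

/-- The lift is injective: `(e, d) ↦ lift e d`. [folklore] -/
theorem lift_injective : Function.Injective (fun p : Fin 2 × (ZMod M × ZMod M) ↦ lift M p.1 p.2) := by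
  rintro ⟨e, d⟩ ⟨e', d'⟩ h
  simp only [lift, Prod.mk.injEq] at h
  obtain ⟨h1, h2⟩ := h
  have hM : 0 < M := Nat.pos_of_ne_zero (NeZero.ne M)
  have hd2 : d.2.val < M := ZMod.val_lt _
  have hd2' : d'.2.val < M := ZMod.val_lt _
  have hd1 : d.1.val < M := ZMod.val_lt _
  have hd1' : d'.1.val < M := ZMod.val_lt _
  have he : (e : ℕ) < 2 := e.isLt
  have he' : (e' : ℕ) < 2 := e'.isLt
  -- second coordinates: both representatives are `< 2M`
  have h2' : d.2.val + e * M = d'.2.val + e' * M := by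
    have := (ZMod.natCast_eq_natCast_iff' _ _ _).mp h2
    rwa [Nat.mod_eq_of_lt (by nlinarith), Nat.mod_eq_of_lt (by nlinarith)] at this
  have hee : (e : ℕ) = e' := by
    rcases Nat.lt_or_ge (e : ℕ) (e' : ℕ) with hlt | hge
    · exfalso; nlinarith
    · rcases Nat.lt_or_ge (e' : ℕ) (e : ℕ) with hlt | hge'
      · exfalso; nlinarith
      · omega
  have hd22 : d.2.val = d'.2.val := by rw [hee] at h2'; omega
  -- first coordinates: `2 d₁ ≡ 2 d₁' (mod 2M)`
  have h1' : (2 * d.1.val) % (2 * M) = (2 * d'.1.val) % (2 * M) := by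
    have := (ZMod.natCast_eq_natCast_iff' _ _ _).mp h1
    rw [hd22, hee] at this
    have h3 : (2 * d.1.val + (d'.2.val + e' * M)) % (2 * M) =
        (2 * d'.1.val + (d'.2.val + e' * M)) % (2 * M) := by
      simpa [add_assoc] using this
    exact Nat.ModEq.add_right_cancel' _ h3
  rw [Nat.mul_mod_mul_left, Nat.mul_mod_mul_left] at h1'
  have hd11 : d.1.val = d'.1.val := by
    have := Nat.eq_of_mul_eq_mul_left two_pos h1'
    rwa [Nat.mod_eq_of_lt hd1, Nat.mod_eq_of_lt hd1'] at this
  refine Prod.ext (Fin.ext hee) (Prod.ext (ZMod.val_injective _ hd11) (ZMod.val_injective _ hd22))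

/-- Every class of `ℤ²` modulo `2M` with `y₁ ≡ y₂ (2)` is a lift. [folklore] -/
theorem exists_lift_eq (c : ZMod (2 * M) × ZMod (2 * M)) (hc : (2 : ℤ) ∣ (c.1.val : ℤ) - c.2.val) :
    ∃ e : Fin 2, ∃ d : ZMod M × ZMod M, lift M e d = c := by
  have hM : 0 < M := Nat.pos_of_ne_zero (NeZero.ne M)
  have hv2 : c.2.val < 2 * M := ZMod.val_lt _
  -- `e` and `d₂`
  obtain ⟨e, d₂, he, hd₂, h2⟩ : ∃ e d₂ : ℕ, e < 2 ∧ d₂ < M ∧ c.2.val = d₂ + e * M := by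
    rcases Nat.lt_or_ge c.2.val M with h | h
    · exact ⟨0, c.2.val, by norm_num, h, by simp⟩
    · exact ⟨1, c.2.val - M, by norm_num, by omega, by omega⟩
  obtain ⟨k, hk⟩ := hc
  refine ⟨⟨e, he⟩, ((k : ZMod M), (d₂ : ZMod M)), Prod.ext ?_ ?_⟩
  · -- first coordinate: `2v + d₂ + eM ≡ c₁ (mod 2M)` for `v = (k mod M).val ≡ k (mod M)`
    simp only [lift]
    rw [ZMod.val_natCast, Nat.mod_eq_of_lt hd₂]
    set v : ℕ := ((k : ZMod M)).val with hv
    have hdvd : (M : ℤ) ∣ (v : ℤ) - k := by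
      rw [← ZMod.intCast_eq_intCast_iff_dvd_sub, Int.cast_natCast, hv, ZMod.natCast_zmod_val]
    obtain ⟨t, ht⟩ := hdvd
    have hc2 : (c.2.val : ℤ) = (d₂ : ℤ) + (e : ℤ) * M := by exact_mod_cast h2
    have hc1 : (c.1.val : ℤ) = 2 * k + ((d₂ : ℤ) + (e : ℤ) * M) := by linear_combination hk + hc2
    have goal : (((2 * v + d₂ + e * M : ℕ) : ℤ) : ZMod (2 * M)) =
        (((c.1.val : ℕ) : ℤ) : ZMod (2 * M)) := by
      rw [ZMod.intCast_eq_intCast_iff_dvd_sub]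
      refine ⟨-t, ?_⟩
      push_cast
      linear_combination hc1 - 2 * ht
    rw [Int.cast_natCast, Int.cast_natCast, ZMod.natCast_zmod_val] at goal
    exact goal
  · -- second coordinate
    simp only [lift]
    rw [ZMod.val_natCast, Nat.mod_eq_of_lt hd₂, ← h2, ZMod.natCast_zmod_val]

/-- **The finite formula on `𝒪_q`**: for `Φ : ℤ × ℤ → ℂ` periodic modulo `M` (a function on
`𝒪_q/M𝒪_q`, `γ = d₁ + d₂ω_q ↔ (d₁, d₂)`),

  `thetaLFunction q (2M) 1 (-τ_q) Φ♯ 1 = (2M)⁻¹ ∑_{d mod M} Φ(d) E₁((d₁ + d₂ω_q)/M; 𝒪_q)`,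

i.e. the value at `s = 1` of the entire continuation of `∑_{γ ∈ 𝒪_q∖0} Φ(γ) \overline{2γ}|2γ|^{-2s}`
(written on `Λ_q` through `Φ♯ = parityLift Φ`) is a finite combination of Eisenstein numbers of
`𝒪_q` — Rubin's Prop. 7.15 at `k = 1` for odd discriminants, from the `Λ_q` formula
`BinaryLattice.thetaLFunction_one_eq_sum_eisensteinE₁` at modulus `2M` by regrouping the classes of
`ℤ²/2M` over those of `𝒪_q/M` (`lift`) and `E₁(z; 𝒪_q) = E₁(z; Λ_q) + E₁(z + ω_q; Λ_q)`.
[cite: Rubin1999, §7.4 Prop. 7.15 (LNM 1716 p. 245)] -/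
theorem thetaLFunction_parityLift_one (Φ : ℤ × ℤ → ℂ)
    (hΦ : ∀ d z : ℤ × ℤ, Φ (d.1 + M * z.1, d.2 + M * z.2) = Φ d) :
    thetaLFunction q (2 * M) 1 (-((Real.sqrt q : ℂ) * I)) (parityLift Φ) 1 =
      ((2 * M : ℕ) : ℂ)⁻¹ * ∑ d : ZMod M × ZMod M,
        Φ ((d.1.val : ℤ), (d.2.val : ℤ)) * (periodPair q).eisensteinE₁ (divPoint q M d) := by
  classical
  rw [BinaryLattice.thetaLFunction_one_eq_sum_eisensteinE₁ q (2 * M) (parityLift Φ)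
    (parityLift_periodic M Φ hΦ)]
  congr 1
  -- the summand on `ℤ²/2M`
  set F : ZMod (2 * M) × ZMod (2 * M) → ℂ := fun c ↦
    parityLift Φ (rep (2 * M) c 0) * (BinaryLattice.periodPair q).eisensteinE₁
      (BinaryLattice.divPoint q (2 * M) c) with hF
  -- restrict to the image of `lift` (off it the parity coefficient vanishes)
  set T : Finset (ZMod (2 * M) × ZMod (2 * M)) :=
    (Finset.univ : Finset (Fin 2 × (ZMod M × ZMod M))).image fun p ↦ lift M p.1 p.2 with hT
  have hzero : ∀ c ∈ (Finset.univ : Finset (ZMod (2 * M) × ZMod (2 * M))), c ∉ T → F c = 0 := by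
    intro c _ hc
    have hpar : ¬ (2 : ℤ) ∣ (c.1.val : ℤ) - c.2.val := by
      intro h
      obtain ⟨e, d, hed⟩ := exists_lift_eq M c h
      exact hc (Finset.mem_image.mpr ⟨(e, d), Finset.mem_univ _, hed⟩)
    simp only [hF, parityLift, rep_fst, rep_snd, Prod.fst_zero, Prod.snd_zero, mul_zero, add_zero]
    rw [if_neg hpar, zero_mul]
  have hsum : ∑ c, F c = ∑ c ∈ T, F c := by
    rw [← Finset.sum_subset (Finset.subset_univ T) hzero]
  change ∑ c, F c = _
  rw [hsum, hT, Finset.sum_image fun p _ p' _ h ↦ lift_injective M h]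
  rw [Fintype.sum_prod_type, Fin.sum_univ_two, ← Finset.sum_add_distrib]
  refine Finset.sum_congr rfl fun d _ ↦ ?_
  -- evaluate the two lifted summands
  have hval : ∀ e : Fin 2, parityLift Φ (rep (2 * M) (lift M e d) 0) = Φ ((d.1.val : ℤ), (d.2.val : ℤ)) := by
    intro e
    obtain ⟨j₁, hj₁⟩ := exists_val_natCast_eq (2 * M) (2 * d.1.val + d.2.val + e * M)
    obtain ⟨j₂, hj₂⟩ := exists_val_natCast_eq (2 * M) (d.2.val + e * M)
    have h1 : (((lift M e d).1.val : ℤ)) = (2 * d.1.val + d.2.val + (e : ℕ) * M : ℕ) + (2 * M : ℕ) * j₁ := by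
      simp only [lift]; exact hj₁
    have h2 : (((lift M e d).2.val : ℤ)) = (d.2.val + (e : ℕ) * M : ℕ) + (2 * M : ℕ) * j₂ := by
      simp only [lift]; exact hj₂
    simp only [parityLift, rep_fst, rep_snd, Prod.fst_zero, Prod.snd_zero, mul_zero, add_zero]
    rw [h1, h2]
    have hdiff : ((2 * d.1.val + d.2.val + (e : ℕ) * M : ℕ) : ℤ) + (2 * M : ℕ) * j₁ -
        (((d.2.val + (e : ℕ) * M : ℕ) : ℤ) + (2 * M : ℕ) * j₂) = 2 * (d.1.val + M * (j₁ - j₂)) := by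
      push_cast; ring
    rw [hdiff, if_pos (dvd_mul_right 2 _), Int.mul_ediv_cancel_left _ two_ne_zero]
    have := hΦ ((d.1.val : ℤ), (d.2.val : ℤ)) (j₁ - j₂, (e : ℕ) + 2 * j₂)
    simp only at this
    rw [← this]
    congr 1
    push_cast
    ring
  simp only [hF, hval, eisensteinE₁_divPoint_lift]
  rw [eisensteinE₁_eq_add q (divPoint q M d)]
  simp only [Fin.val_zero, Fin.val_one, Nat.cast_zero, Nat.cast_one, zero_mul, one_mul, add_zero]
  ring

end QuadOrder

end Literature.NumberTheory.EllipticCurves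

end
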